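import Summits.QuantumFields.YangMills.Theorems.SwapVirialDeficitBlowUpGnomonicCartHubFrame
import Summits.QuantumFields.YangMills.Theorems.SwapVirialDeficitBlowUpGnomonicCartHubBasics
import Summits.QuantumFields.YangMills.Theorems.SwapVirialDeficitSectorLaplaceTipWindowReading
import Mathlib.MeasureTheory.Group.Integral
import HarnessLib

/-!
# Route `SwapVirialDeficit` (YangMills): THE CENTRE OF `SU(2)` ON THE SEAM — `I(−a, ε; b) = I(a, ε; b)`, hence `I(hubAt (−δ) 1) = I(hubAt δ 1)` and the tip window is twice its `δ > 0` half
# (cell ym-idea-1, skeleton ➎ v14 (ONE sorry: `stub_core_tip`); g49's tip-plug question 2026-09-01T00:38Z «who supplies the δ < 0 half»;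
# free-hands support of ⟨stmt-QuantumFields-24197⟩ `SwapVirialDeficit.SwapGluedStiffness`)

The seam leader `C₃` of a chart point enters the σ-glued ring deficit `F^S_z` ONLY through the seam field `g = seamField χ C₃ V`, which acts as a GAUGE TRANSFORMATION
(✓`swapRingExponent`: `K(U_{2L−1}, g·tw_z(σU_0))`); a gauge transformation by `Z·g` with `Z` central equals the one by `g`.  So `F^S_z` is blind to the centre on the seam:
* §1 `quatToSU2_neg_one_comm` (`Q(−1)` is central), `gaugeTransform_centre_mul`, `seamField_centre_mul`, ★ `chartDeficit_seam_centre` —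
  `chartDeficit z χ (![C₀, C₁, C₂, Q(−1)·C₃], U) = chartDeficit z χ (![C₀, C₁, C₂, C₃], U)` (ANY background `χ`);
* §2 in w2 g60's fixed-frame chart (✓`leaderTupleCart`, hub link `a/‖a‖` itself): `leaderTupleCart (−a) w = ![…, Q(−1)·Q(a/‖a‖)]` (`radialUnit (−a) = −radialUnit a`,
  `slaveP (−A) = slaveP A`, ✓`quatToSU2_neg`), ★ `gnoDeficitCart_neg` — `F̂cart_{z,χ}(−a, ε, η) = F̂cart_{z,χ}(a, ε, η)` POINTWISE;
* §3 ★★ `hubIntegral_neg` — `I(−a, ε; b) = I(a, ε; b)` (`a ≠ 0`; ✓`hubIntegral_eq_cart` at `a` and at `−a`, ✓`exists_hubFrame`), ★★ `hubIntegral_hubAt_neg` —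
  `I(hubAt (−δ) 1, ε; b) = I(hubAt δ 1, ε; b)` (`hubAt (−δ) 1` and `−hubAt δ 1` share the letter `−δ`, ✓`hubIntegral_eq_hubCot`);
* §4 ★ `tipWindow_eq_two_mul_pos` — `∫_{(1+δ²)⁻¹ < τ} ((1+δ²)⁻¹)²·I(hubAt δ 1) dδ = 2·∫_{(1+δ²)⁻¹ < τ ∧ 0 < δ} ((1+δ²)⁻¹)²·I(hubAt δ 1) dδ` — so the tip plug
  (✓`tipWindow_eq_integral_hubIntegral`, g49) runs the `δ > 0` side only: the «antipodal apex» `θ → π` is the apex `θ → 0` seen through the centre.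

HONEST LABEL: symmetry bookkeeping; (H′), the `Boxᶜ` mass, tip-core, thresholds and the assembly of `hT` remain; `stub_core_tip`, ⟨24197⟩ ∕ ⟨24194⟩ OPEN; own crux ⟨22884⟩
`LargeFieldMassRefinementTail` OPEN (blocked-on ⟨19935⟩); the Yang–Mills mass gap is NOT proved; no summit is proved by a line.  THEOREMS ONLY (0 `def`, 0 `sorry`, no instance),
standard axioms.  Width seat ym-line-sfw-p2-w3 g68 (cell ym-idea-1, free hands), `--supports stmt-QuantumFields-24197`.  References: [cite: tHooft1979]; [folklore].
-/

set_option autoImplicit false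
set_option synthInstance.maxSize 1024

noncomputable section

open MeasureTheory Quaternion Set Filter
open scoped Quaternion BigOperators ENNReal
open Literature.MathematicalPhysics.QuantumLattice
open Literature.MathematicalPhysics.QuantumFieldTheory hiding SU2
open Summit.QuantumFields.YangMills.Theorems.SwapTwistDeficit.ToronLog

namespace Summit.QuantumFields.YangMills.Theorems.SwapVirialDeficit.BlowUpRing

open Summit.QuantumFields.YangMills.Theorems.FemtoTransferGap
open Summit.QuantumFields.YangMills.Theorems.FemtoTransferGap.TT
open Summit.QuantumFields.YangMills.Theorems.VirialFluxGap.RingDeficit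
open Summit.QuantumFields.YangMills.Theorems.SwapVirialDeficit.SwapRing
open Summit.QuantumFields.YangMills.Theorems.SwapVirialDeficit.SectorLaplace
open Literature.Analysis.Calculus (radialUnit radialUnit_def norm_radialUnit)
open Summit.QuantumFields.YangMills.Theorems.SwapVirialDeficit.ZeroModeSigma (slaveP slaveP_def)

variable {L : ℕ} [NeZero L]

/-! ## §1 The centre of `SU(2)` on the seam leader -/

omit [NeZero L] in
/-- `Q(−1)` is central in `SU(2)` (its matrix is `−1`). [folklore] -/
theorem quatToSU2_neg_one_comm (U : SU2) : quatToSU2 (-1 : ℍ) * U = U * quatToSU2 (-1 : ℍ) := by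
  have h1 : (-1 : ℍ) ≠ 0 := neg_ne_zero.2 one_ne_zero
  have hc : ((quatToSU2 (-1 : ℍ) : SU2) : Matrix (Fin 2) (Fin 2) ℂ) = -1 := by
    rw [coe_quatToSU2 h1, norm_neg, norm_one, inv_one, one_smul, quatMatrix_neg, quatMatrix_one]
  apply Subtype.ext
  rw [Submonoid.coe_mul, Submonoid.coe_mul, hc]
  simp

omit [NeZero L] in
/-- A gauge transformation by `Z·g`, `Z` central, is the gauge transformation by `g`. [folklore] -/
theorem gaugeTransform_centre_mul {Z : SU2} (hZ : ∀ U : SU2, Z * U = U * Z) (g : Site 3 L → SU2) (U : GaugeConfig 3 L SU2) :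
    gaugeTransform (fun x => Z * g x) U = gaugeTransform g U := by
  funext e
  show Z * g e.1 * U e * (Z * g (e.1.shift e.2))⁻¹ = g e.1 * U e * (g (e.1.shift e.2))⁻¹
  calc Z * g e.1 * U e * (Z * g (e.1.shift e.2))⁻¹ = Z * (g e.1 * U e * (g (e.1.shift e.2))⁻¹) * Z⁻¹ := by
        rw [mul_inv_rev]; simp only [mul_assoc]
    _ = (g e.1 * U e * (g (e.1.shift e.2))⁻¹) * Z * Z⁻¹ := by rw [hZ]
    _ = g e.1 * U e * (g (e.1.shift e.2))⁻¹ := by rw [mul_inv_cancel_right]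

omit [NeZero L] in
/-- The seam field of a centre-shifted seam leader: `seamField χ (Z·c) V = Z·seamField χ c V` (central `Z`). [folklore] -/
theorem seamField_centre_mul (χ : Site 3 L → SU2) {Z : SU2} (hZ : ∀ U : SU2, Z * U = U * Z)
    (c : SU2) (V : SeamRest L → SU2) : seamField χ (Z * c) V = fun x => Z * seamField χ c V x := by
  funext x
  unfold seamField
  by_cases h : x = 0
  · rw [dif_pos h, dif_pos h]
  · rw [dif_neg h, dif_neg h, ← mul_assoc (χ x), ← hZ (χ x), mul_assoc Z, mul_assoc Z]

/-- ★ **THE RING DEFICIT IS BLIND TO THE CENTRE ON THE SEAM**: `chartDeficit z χ (![C₀, C₁, C₂, Q(−1)·C₃], U) = chartDeficit z χ (![C₀, C₁, C₂, C₃], U)` (any `χ`) —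
the seam leader acts as a gauge transformation (✓`swapRingExponent`), and `gaugeTransform (Z·g) = gaugeTransform g`. [cite: tHooft1979] -/
theorem chartDeficit_seam_centre (z : Fin 3 → Bool) (χ : Site 3 L → SU2) (C₀ C₁ C₂ C₃ : SU2) (U : Fol L → SU2) :
    chartDeficit L z χ ((![C₀, C₁, C₂, quatToSU2 (-1 : ℍ) * C₃] : Fin 4 → SU2), U) = chartDeficit L z χ ((![C₀, C₁, C₂, C₃] : Fin 4 → SU2), U) := by
  have hZ := quatToSU2_neg_one_comm
  -- the first three leaders agree
  have hcast : (fun μ : Fin 3 => (![C₀, C₁, C₂, quatToSU2 (-1 : ℍ) * C₃] : Fin 4 → SU2) (Fin.castSucc μ)) =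
      fun μ : Fin 3 => (![C₀, C₁, C₂, C₃] : Fin 4 → SU2) (Fin.castSucc μ) := by
    funext μ; fin_cases μ <;> rfl
  have hlast : (![C₀, C₁, C₂, quatToSU2 (-1 : ℍ) * C₃] : Fin 4 → SU2) (Fin.last 3) = quatToSU2 (-1 : ℍ) * C₃ := rfl
  have hlast' : (![C₀, C₁, C₂, C₃] : Fin 4 → SU2) (Fin.last 3) = C₃ := rfl
  -- the rebuilt coordinates differ by the centre on the seam field only
  have hrc : ringConfig χ ((![C₀, C₁, C₂, quatToSU2 (-1 : ℍ) * C₃] : Fin 4 → SU2), U) =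
      ((ringConfig χ ((![C₀, C₁, C₂, C₃] : Fin 4 → SU2), U)).1,
        ((ringConfig χ ((![C₀, C₁, C₂, C₃] : Fin 4 → SU2), U)).2.1,
          fun x => quatToSU2 (-1 : ℍ) * (ringConfig χ ((![C₀, C₁, C₂, C₃] : Fin 4 → SU2), U)).2.2 x)) := by
    unfold ringConfig
    simp only [hcast, hlast, hlast', seamField_centre_mul χ hZ]
  unfold chartDeficit
  rw [hrc]
  unfold fixHistory swapRingDeficit swapRingExponent
  simp only [gaugeTransform_centre_mul hZ]

/-! ## §2 The fixed-frame chart at the antipodal hub -/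

omit [NeZero L] in
/-- `radialUnit (−a) = −radialUnit a`. [folklore] -/
theorem radialUnit_neg' (a : ℍ) : radialUnit (-a) = -radialUnit a := by
  rw [radialUnit_def, radialUnit_def, norm_neg, smul_neg]

omit [NeZero L] in
/-- `slaveP (−A) x = slaveP A x`. [folklore] -/
theorem slaveP_neg (A x : ℍ) : slaveP (-A) x = slaveP A x := by
  rw [slaveP_def, slaveP_def, star_neg, neg_mul, neg_mul, mul_neg, neg_neg]

omit [NeZero L] in
/-- ★ The fixed-frame tuple at `−a` is the one at `a` with the seam leader multiplied by `Q(−1)` (`a ≠ 0`). [folklore] -/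
theorem leaderTupleCart_neg {a : ℍ} (ha : a ≠ 0) (w : (ℍ × ℍ) × ℍ) :
    leaderTupleCart (-a) w = (![quatToSU2 w.1.1, quatToSU2 (slaveP (radialUnit a) w.1.1 * w.2), quatToSU2 w.1.2,
      quatToSU2 (-1 : ℍ) * quatToSU2 (radialUnit a)] : Fin 4 → SU2) := by
  have hA0 : radialUnit a ≠ 0 := radialUnit_ne_zero' ha
  unfold leaderTupleCart
  rw [radialUnit_neg', slaveP_neg, quatToSU2_neg hA0]

omit [NeZero L] in
/-- The fixed-frame tuple at `a`, written out. [folklore] -/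
theorem leaderTupleCart_eq (a : ℍ) (w : (ℍ × ℍ) × ℍ) :
    leaderTupleCart a w = (![quatToSU2 w.1.1, quatToSU2 (slaveP (radialUnit a) w.1.1 * w.2), quatToSU2 w.1.2, quatToSU2 (radialUnit a)] : Fin 4 → SU2) := rfl

/-- ★ **THE FIXED-FRAME DEFICIT IS EVEN IN THE HUB**: `F̂cart_{z,χ}(−a, ε, η) = F̂cart_{z,χ}(a, ε, η)` for `a ≠ 0`, any `χ`, every `η` (pointwise; §1). [cite: tHooft1979] -/
theorem gnoDeficitCart_neg (z : Fin 3 → Bool) (χ : Site 3 L → SU2) {a : ℍ} (ha : a ≠ 0)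
    (ε : GnoSign L) (η : GnoCoord L) : gnoDeficitCart z χ (-a) ε η = gnoDeficitCart z χ a ε η := by
  unfold gnoDeficitCart cartPoint
  rw [leaderTupleCart_neg ha, leaderTupleCart_eq]
  exact chartDeficit_seam_centre z χ _ _ _ _ _

/-! ## §3 The hub integral is even in the hub -/

/-- ★★ **`I(−a, ε; b) = I(a, ε; b)`** for every hub `a ≠ 0`, signs `ε` and `b` (✓`hubIntegral_eq_cart` at `a` and `−a`, ✓`exists_hubFrame`, §2). [cite: tHooft1979] -/
theorem hubIntegral_neg {a : ℍ} (ha : a ≠ 0) (ε : GnoSign L) (b : ℝ) : hubIntegral (L := L) (-a) ε b = hubIntegral a ε b := by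
  have hna : -a ≠ 0 := neg_ne_zero.2 ha
  obtain ⟨u, hu, hua⟩ := exists_hubFrame a
  obtain ⟨u', hu', hua'⟩ := exists_hubFrame (-a)
  rw [← hubIntegral_eq_cart ha hu hua ε b, ← hubIntegral_eq_cart hna hu' hua' ε b]
  refine integral_congr_ae (Eventually.of_forall fun η => ?_)
  show Real.exp (-(b * gnoDeficitCart z₀ (fun _ => 1) (-a) ε η)) * gnoDensity η = Real.exp (-(b * gnoDeficitCart z₀ (fun _ => 1) a ε η)) * gnoDensity η
  rw [gnoDeficitCart_neg z₀ (fun _ => (1 : SU2)) ha]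

/-- ★★ **`I(hubAt (−δ) 1, ε; b) = I(hubAt δ 1, ε; b)`** — the two ends `δ → ±∞` of the tip carry the same hub integrals (`hubAt (−δ) 1` and `−hubAt δ 1` have the same
letter `−δ`, ✓`hubIntegral_eq_hubCot`; then §3). [cite: tHooft1979] -/
theorem hubIntegral_hubAt_neg (δ : ℝ) (ε : GnoSign L) (b : ℝ) : hubIntegral (L := L) (hubAt (-δ) 1) ε b = hubIntegral (hubAt δ 1) ε b := by
  have him : (-(hubAt δ 1)).im ≠ 0 := by
    rw [Quaternion.im_neg]
    exact neg_ne_zero.2 (hubAt_one_im_ne_zero δ)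
  have hcot : (-(hubAt δ 1)).re / ‖(-(hubAt δ 1)).im‖ = -δ := by
    rw [Quaternion.re_neg, Quaternion.im_neg, norm_neg, norm_im_hubAt_one, div_one]
    rfl
  have h1 : hubIntegral (L := L) (-(hubAt δ 1)) ε b = hubIntegral (hubAt (-δ) 1) ε b := by
    rw [hubIntegral_eq_hubCot (L := L) him, hcot]
  rw [← h1, hubIntegral_neg (hubAt_one_ne_zero δ)]

/-! ## §4 The tip window is twice its positive half -/

omit [NeZero L] in
/-- Reflection: for an even function `f` and a set `S` with `−S = T`, `∫_S f = ∫_T f`. [folklore] -/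
theorem setIntegral_eq_of_neg {f : ℝ → ℝ} (hf : ∀ x, f (-x) = f x) {S T : Set ℝ} (hS : MeasurableSet S) (hT : MeasurableSet T)
    (hST : ∀ x, -x ∈ S ↔ x ∈ T) : ∫ x in S, f x = ∫ x in T, f x := by
  rw [← integral_indicator hS, ← integral_indicator hT, ← integral_neg_eq_self (S.indicator f) volume]
  refine integral_congr_ae (Eventually.of_forall fun x => ?_)
  show S.indicator f (-x) = T.indicator f x
  by_cases hx : x ∈ T
  · rw [indicator_of_mem ((hST x).2 hx), indicator_of_mem hx, hf]
  · rw [indicator_of_notMem (fun h => hx ((hST x).1 h)), indicator_of_notMem hx]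

/-- ★ **THE TIP WINDOW IS TWICE ITS `δ > 0` HALF**: for every `τ`, `ε`, `b ≥ 0`,
`∫_{(1+δ²)⁻¹ < τ} ((1+δ²)⁻¹)²·I(hubAt δ 1) dδ = 2·∫_{(1+δ²)⁻¹ < τ ∧ 0 < δ} ((1+δ²)⁻¹)²·I(hubAt δ 1) dδ` (§3; the integrand is even and integrable, ✓`integrable_sqInv_mul_hubIntegral_hubAt`).
[folklore] -/
theorem tipWindow_eq_two_mul_pos (ε : GnoSign L) (τ : ℝ) {b : ℝ} (hb : 0 ≤ b) :
    ∫ δ in {δ : ℝ | (1 + δ ^ 2)⁻¹ < τ}, ((1 + δ ^ 2)⁻¹) ^ 2 * hubIntegral (L := L) (hubAt δ 1) ε b =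
      2 * ∫ δ in {δ : ℝ | (1 + δ ^ 2)⁻¹ < τ ∧ 0 < δ}, ((1 + δ ^ 2)⁻¹) ^ 2 * hubIntegral (L := L) (hubAt δ 1) ε b := by
  set f : ℝ → ℝ := fun δ => ((1 + δ ^ 2)⁻¹) ^ 2 * hubIntegral (L := L) (hubAt δ 1) ε b with hf
  have hfeven : ∀ x, f (-x) = f x := fun x => by
    simp only [hf, neg_sq, hubIntegral_hubAt_neg]
  have hw : Measurable fun δ : ℝ => (1 + δ ^ 2)⁻¹ := (measurable_const.add (measurable_id.pow_const 2)).inv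
  have hW : MeasurableSet {δ : ℝ | (1 + δ ^ 2)⁻¹ < τ} := measurableSet_lt hw measurable_const
  have hP : MeasurableSet {δ : ℝ | (1 + δ ^ 2)⁻¹ < τ ∧ 0 < δ} := hW.inter (measurableSet_lt measurable_const measurable_id)
  have hN : MeasurableSet {δ : ℝ | (1 + δ ^ 2)⁻¹ < τ ∧ δ < 0} := hW.inter (measurableSet_lt measurable_id measurable_const)
  have hint : Integrable f := integrable_sqInv_mul_hubIntegral_hubAt (L := L) ε hb
  -- split the window at `δ = 0` (a null set)
  have hsplit : {δ : ℝ | (1 + δ ^ 2)⁻¹ < τ} =ᵐ[volume] ({δ : ℝ | (1 + δ ^ 2)⁻¹ < τ ∧ 0 < δ} ∪ {δ : ℝ | (1 + δ ^ 2)⁻¹ < τ ∧ δ < 0} : Set ℝ) := by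
    have hsub1 : ({δ : ℝ | (1 + δ ^ 2)⁻¹ < τ ∧ 0 < δ} ∪ {δ : ℝ | (1 + δ ^ 2)⁻¹ < τ ∧ δ < 0} : Set ℝ) ⊆ {δ : ℝ | (1 + δ ^ 2)⁻¹ < τ} := by
      intro x hx; rcases hx with h | h <;> exact h.1
    have hsub2 : {δ : ℝ | (1 + δ ^ 2)⁻¹ < τ} \ ({δ : ℝ | (1 + δ ^ 2)⁻¹ < τ ∧ 0 < δ} ∪ {δ : ℝ | (1 + δ ^ 2)⁻¹ < τ ∧ δ < 0}) ⊆ {0} := by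
      intro x hx
      obtain ⟨h1, h2⟩ := hx
      simp only [mem_union, mem_setOf_eq, not_or, not_and, not_lt] at h2
      have ha := h2.1 h1
      have hb' := h2.2 h1
      exact mem_singleton_iff.2 (le_antisymm ha hb')
    refine (ae_eq_set).2 ⟨?_, ?_⟩
    · exact measure_mono_null hsub2 (measure_singleton 0)
    · rw [Set.sdiff_eq_empty.2 hsub1]; exact measure_empty
  have hdisj : Disjoint {δ : ℝ | (1 + δ ^ 2)⁻¹ < τ ∧ 0 < δ} {δ : ℝ | (1 + δ ^ 2)⁻¹ < τ ∧ δ < 0} := by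
    rw [Set.disjoint_left]
    intro x hx hx'
    exact lt_asymm hx.2 hx'.2
  rw [setIntegral_congr_set hsplit, setIntegral_union hdisj hN hint.integrableOn hint.integrableOn]
  have hrefl : ∫ x in {δ : ℝ | (1 + δ ^ 2)⁻¹ < τ ∧ δ < 0}, f x = ∫ x in {δ : ℝ | (1 + δ ^ 2)⁻¹ < τ ∧ 0 < δ}, f x := by
    refine setIntegral_eq_of_neg hfeven hN hP fun x => ?_
    simp only [mem_setOf_eq, neg_sq, neg_lt_zero]
  rw [hrefl]
  ring

end Summit.QuantumFields.YangMills.Theorems.SwapVirialDeficit.BlowUpRing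

end
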